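/-
Copyright: statement-level skeleton of a published paper (lit-balaban cell, Phase-2 proof seat p39 gen 7). No proof claims
beyond what the kernel checks below.
-/
import Literature.MathematicalPhysics.QuantumFieldTheory.Balaban1983to89.B3MxiFubiniBound

/-!
# B3 — T. Bałaban, *(Higgs)₂,₃ quantum fields in a finite volume. III. Renormalization*, CMP **88** (1983) 411–445
[Balaban1983Higgs3], p. 441 [PDF 31]: the replacement of the propagator in the vector self-energy function `Π_{μμ′ν}` of (3.26),
verbatim: *"Next we replace the propagator G_{j₀}(0) by C^ξ, ξ = L^{−j₀}, using the same equation as in (3.16). If at least one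
propagator G_{j₀}(0) is replaced by G_{j₀}(0)(1 − m²_{j₀} − a_{j₀}P_{j₀})C^ξ, then we get a convergent expression. Hence it is
enough to consider the expressions with the propagator C^ξ only."* — PROVED for r15's `B3Sect3VectorSelfEnergy.Pi3` (= Π_{μμ′ν},
the kernel of the first curly bracket of (3.26) with the displacement `(x′_ν − x_ν)`) AT THE ZERO-FIELD TORUS INSTANCE, `d = 3`:
with `M = G^ξ_k(0) − C^ξ_T` (`B3Eq316ResolventZeroTorus.Mxi`) every configuration of the two propagator slots containing at least
one `M` is bounded by `Cst·|tr q²|` uniformly in the volume and in `k`, and hence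
`|Π_{μμ′ν}[G^ξ_k(0), G^ξ_k(0)](y) − Π_{μμ′ν}[C^ξ_T, C^ξ_T](y)| ≤ Cst·|tr q²|`

statement-level skeleton of published theorems with citation tags; proofs where landed; nothing here is a claim about
the Yang–Mills mass gap

PDF held: `paper:balaban1983-higgs-2-3-quantum-fields-finite-volume` (journal page = PDF page + 410); p. 441 read on the ×2 render
`run/shared/lean/pub/pub-balaban/b2b-balaban-ref1/pages/1983-cmp88-higgs23-III/1983-cmp88-higgs23-III-p031-x2.png`, p. 440 on
`…-p030-x2.png`.  Row **B3.Eq3.25-3.32** of `HOME/lit-balaban-r15/ROWS-B3.md` (fold owner r15; `Pi3`, `kerA`, `kerB`, `kerC` are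
r15's).  Mechanism (published: *"the same equation as in (3.16)"* + the kernel bounds p. 437): `Π_{μμ′ν}[X,Y](x) =
Σ_{x′}ξ^d tr q²[−(X∂^*_{μ′})(x,x′)(Y∂^*_μ)(x′,x) + X(x,x′)(∂_{μ′}Y∂^*_μ)(x′,x)](x′_ν − x_ν)`; with the kernel shapes of this seat's
`B3ZeroTorusKernelProfiles.G0xi_all_bounds` (`G`: `P₁, P₂, P₂, P₃`), `B3MxiFubiniBound.Mxi_profiles` (`M`: `O(1), P₁, P₁, P₁`),
`B3Eq323CrossTermsZeroTorus.abs_CxiT_profile` / `dAdjKernel_CxiT_profile` (`C^ξ_T`: `P₁, P₂`) and `|x′_ν − x_ν| ≤ 3ξ·max(1,|x−x′|_∞)`,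
every summand with one `M` is `O(ξ^d(ξ·max(1,|x−x′|))^{−2}e^{−δξ|x−x′|})` or better, whose lattice sum is bounded
(`B3KernelConvolutionTorus.sum_profile_le`, `…Sup.sum_profile_one_le`, `sum_exp_le`).
* §1 `kerC_sub_left`, `kerC_sub_right`, `Pi3_sub_left`, `Pi3_sub_right`, `Pi3_split` (bilinearity: `Π[G,G] − Π[C,C] = Π[M,G] + Π[C,M]`).
* §2 `sum_term_le` (the generic summand estimate), `Pi3_abs_le`.
* §3 **`Pi3_replaced_convergent`** (the five configurations `[M,G], [G,M], [M,M], [C,M], [M,C]` are `≤ Cst·|tr q²|` for every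
  displacement reading `dx` with `|dx_ν(x,x′)| ≤ ξ|x−x′|₁`), **`Pi3_G0xi_sub_CxiT`** (the difference `Π[G,G] − Π[C,C]`), and
  **`Pi3_G0xi_sub_CxiT_disp`** (the instance `dx = B3Taylor310Remainder.disp ξ⁻¹` of r15's (3.26)/(3.10) files).
HONEST SCOPE: the model instance `A = B̃ = 0`, `U ≡ 1`, `Ω` = the whole torus, `d = 3`, on the `ξ = L^{−k}` lattice (the
rescaled functions `Π^{(L^{−j₀},j₀)}`; the `η`-lattice originals differ by the factor `(L^{j₀}η)^{−d+3} = 1`, r15's `Pi3_rescale`);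
constants existential (functions of `L, a, m²`).  The vanishing (3.27)–(3.28) of the pure-`C^ξ` term is NOT touched here (rows of
r15/p20).  Mathlib + the cited tree files only; theorems only, no definitions, no named facts; standard axioms.  Unit
`lit-balaban-p39-g7` (Phase-2 proof seat p39, gen 7), HOME `run/shared/lean/pub/lit-balaban/`, 2026-08-21.
-/

open scoped BigOperators

namespace Literature.MathematicalPhysics.QuantumFieldTheory.Balaban1983to89.B3Pi3CrossTermsZeroTorus

open Matrix Finset B1RG242Torus B3GkZeroTorusRescaled B3Eq316ResolventZeroTorus B3KernelConvolutionTorus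
open B3KernelConvolutionTorusSup B3Bound316ZeroTorus B3Eq323CrossTermsZeroTorus
open LatticeFieldCalculus B3Sect3ScalarSelfEnergy B3TorusRadialSums B3Bound316 B3CxiTorusBound
open B3ZeroTorusKernelProfiles B3MxiDifferenceProfiles B3MxiFubiniBound B3Taylor310Remainder
open B3Sect3VectorSelfEnergy (dAdjKernel d2Kernel kerA kerB kerC Pi3)

noncomputable section

variable {P : Params} {j : ℕ}

/-! ## §1 Bilinearity of the (3.26) kernels in the two propagator slots -/

section Algebra

/-- kernel: the combined (3.26) kernel is linear in the first propagator slot. [cite: Balaban1983Higgs3, (3.26) p.440] -/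
theorem kerC_sub_left (η τ : ℝ) (G H G' : Kernel P j) (μ μ' : Fin P.d) (x x' : Site P j) :
    kerC η τ G G' μ μ' x x' - kerC η τ H G' μ μ' x x' = kerC η τ (G - H) G' μ μ' x x' := by
  simp only [kerC, kerA, kerB, dAdjKernel, d2Kernel, Pi.sub_apply]; ring

/-- kernel: the combined (3.26) kernel is linear in the second propagator slot. [cite: Balaban1983Higgs3, (3.26) p.440] -/
theorem kerC_sub_right (η τ : ℝ) (G G' H' : Kernel P j) (μ μ' : Fin P.d) (x x' : Site P j) :
    kerC η τ G G' μ μ' x x' - kerC η τ G H' μ μ' x x' = kerC η τ G (G' - H') μ μ' x x' := by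
  simp only [kerC, kerA, kerB, dAdjKernel, d2Kernel, Pi.sub_apply]; ring

/-- `Π_{μμ′ν}` is linear in the first slot: `Π[G,G′] − Π[H,G′] = Π[G − H, G′]`. [cite: Balaban1983Higgs3, (3.26) p.441] -/
theorem Pi3_sub_left (η τ : ℝ) (G H G' : Kernel P j) (dx : Fin P.d → Site P j → Site P j → ℝ) (μ μ' ν : Fin P.d) (x : Site P j) :
    Pi3 η τ G G' dx μ μ' ν x - Pi3 η τ H G' dx μ μ' ν x = Pi3 η τ (G - H) G' dx μ μ' ν x := by
  simp only [Pi3, ← Finset.sum_sub_distrib, ← kerC_sub_left]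
  exact Finset.sum_congr rfl fun x' _ => by ring

/-- `Π_{μμ′ν}` is linear in the second slot: `Π[G,G′] − Π[G,H′] = Π[G, G′ − H′]`. [cite: Balaban1983Higgs3, (3.26) p.441] -/
theorem Pi3_sub_right (η τ : ℝ) (G G' H' : Kernel P j) (dx : Fin P.d → Site P j → Site P j → ℝ) (μ μ' ν : Fin P.d) (x : Site P j) :
    Pi3 η τ G G' dx μ μ' ν x - Pi3 η τ G H' dx μ μ' ν x = Pi3 η τ G (G' - H') dx μ μ' ν x := by
  simp only [Pi3, ← Finset.sum_sub_distrib, ← kerC_sub_right]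
  exact Finset.sum_congr rfl fun x' _ => by ring

/-- **`Π[G,G] − Π[C,C] = Π[G − C, G] + Π[C, G − C]`** — the replacement of the propagators one slot at a time.
[cite: Balaban1983Higgs3, (3.26) p.441] -/
theorem Pi3_split (η τ : ℝ) (G C : Kernel P j) (dx : Fin P.d → Site P j → Site P j → ℝ) (μ μ' ν : Fin P.d) (x : Site P j) :
    Pi3 η τ G G dx μ μ' ν x - Pi3 η τ C C dx μ μ' ν x = Pi3 η τ (G - C) G dx μ μ' ν x + Pi3 η τ C (G - C) dx μ μ' ν x := by
  rw [← Pi3_sub_left, ← Pi3_sub_right]; ring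

/-- `M = G^ξ_k(0) − C^ξ_T` as a difference of kernels. [cite: Balaban1983Higgs3, (3.16) p.437] -/
theorem Mxi_eq_sub (a msq : ℝ) (k : ℕ) : Mxi P a msq k = G0xi P a msq k - CxiT (P.eta k) := rfl

/-- `C^ξ_T = G^ξ_k(0) − M`. [cite: Balaban1983Higgs3, (3.16) p.437] -/
theorem CxiT_eq_sub (a msq : ℝ) (k : ℕ) : (CxiT (P.eta k) : Kernel P 0) = G0xi P a msq k - Mxi P a msq k := by
  funext y y'; simp only [Pi.sub_apply, Mxi]; ring

end Algebra

/-! ## §2 The generic summand estimate -/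

section Generic

/-- kernel: along `Γ_{x,x′}` the displacement is at most `3ξ·max(1,|x−x′|_∞)` (`|x−x′|₁ ≤ d|x−x′|_∞`, `d = 3`). [cite: Balaban1983Higgs3, (3.10) p.435] -/
theorem abs_dx_le (hd : P.d = 3) {ξ : ℝ} (hξ : 0 < ξ) (dx : Fin P.d → Site P j → Site P j → ℝ)
    (hdx : ∀ (ν : Fin P.d) (x x' : Site P j), |dx ν x x'| ≤ ξ * (Site.tdist x x' : ℝ)) (ν : Fin P.d) (x x' : Site P j) :
    |dx ν x x'| ≤ 3 * (ξ * max (1 : ℝ) (supDist x x' : ℝ)) := by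
  refine (hdx ν x x').trans ?_
  have h1 : (Site.tdist x x' : ℝ) ≤ 3 * (supDist x x' : ℝ) := by
    have := tdist_le_mul_supDist x x'; rw [hd] at this; exact_mod_cast this
  have h2 : (supDist x x' : ℝ) ≤ max (1 : ℝ) (supDist x x' : ℝ) := le_max_right _ _
  nlinarith [hξ.le]

/-- **The generic summand estimate.**  On the `ξ`-lattice (`d = 3`, `0 < ξ ≤ 1`), if `|f(x′)| ≤ c₁(ξ·max(1,|x−x′|))^{−p}`,
`|g(x′)| ≤ c₂(ξ·max(1,|x−x′|))^{−q}e^{−δξ|x−x′|}` and `|h(x′)| ≤ 3ξ·max(1,|x−x′|)` with `p + q + i = 3`, `i ≤ 2`, then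
`|Σ_{x′}ξ^d·τ f(x′)g(x′)h(x′)| ≤ 3|τ|c₁c₂(1 + radialConst 3 δ 1 i)`: the displacement cancels one power and the remaining
`(ξ·max(1,|x−x′|))^{−(2−i)}e^{−δξ|x−x′|}` is summable (`sum_profile_le`, `sum_profile_one_le`, `sum_exp_le`).
[cite: Balaban1983Higgs3, (3.16) p.437, (3.26) p.441] -/
theorem sum_term_le (hd : P.d = 3) {ξ : ℝ} (hξ : 0 < ξ) (hξ1 : ξ ≤ 1) {δ : ℝ} (hδ : 0 < δ) {p q i : ℕ} (hpq : p + q + i = 3)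
    (hi : i ≤ 2) {c₁ c₂ : ℝ} (hc₁ : 0 ≤ c₁) (hc₂ : 0 ≤ c₂) (τ : ℝ) (x : Site P j) (f g h : Site P j → ℝ)
    (hf : ∀ x' : Site P j, |f x'| ≤ c₁ * ((ξ * max (1 : ℝ) (supDist x x' : ℝ)) ^ p)⁻¹)
    (hg : ∀ x' : Site P j, |g x'| ≤
      c₂ * (((ξ * max (1 : ℝ) (supDist x x' : ℝ)) ^ q)⁻¹ * Real.exp (-(δ * (ξ * (supDist x x' : ℝ))))))
    (hh : ∀ x' : Site P j, |h x'| ≤ 3 * (ξ * max (1 : ℝ) (supDist x x' : ℝ))) :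
    |∑ x' : Site P j, ξ ^ P.d * (τ * (f x' * g x') * h x')| ≤ 3 * |τ| * c₁ * c₂ * (1 + radialConst 3 δ 1 i) := by
  have hw : 0 ≤ ξ ^ P.d := by positivity
  have hpt : ∀ x' : Site P j, |ξ ^ P.d * (τ * (f x' * g x') * h x')| ≤ 3 * |τ| * c₁ * c₂ *
      (ξ ^ P.d * (((ξ * max (1 : ℝ) (supDist x x' : ℝ)) ^ (2 - i))⁻¹ * Real.exp (-(δ * (ξ * (supDist x x' : ℝ)))))) := by
    intro x'
    obtain ⟨u, hu⟩ : ∃ u : ℝ, u = ξ * max (1 : ℝ) (supDist x x' : ℝ) := ⟨_, rfl⟩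
    have hu0 : 0 < u := by rw [hu]; exact mul_pos hξ (lt_max_of_lt_left one_pos)
    obtain ⟨e, he⟩ : ∃ e : ℝ, e = Real.exp (-(δ * (ξ * (supDist x x' : ℝ)))) := ⟨_, rfl⟩
    have he0 : 0 < e := by rw [he]; exact Real.exp_pos _
    have hf' := hf x'; have hg' := hg x'; have hh' := hh x'
    rw [← hu] at hf' hg' hh'; rw [← he] at hg'
    rw [← hu, ← he, abs_mul, abs_of_nonneg hw, abs_mul, abs_mul, abs_mul]
    have hkey : (u ^ p)⁻¹ * (u ^ q)⁻¹ * u = (u ^ (2 - i))⁻¹ := by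
      have h3 : p + q = (2 - i) + 1 := by omega
      rw [← mul_inv, ← pow_add, h3, pow_succ, mul_inv, mul_assoc, inv_mul_cancel₀ hu0.ne', mul_one]
    calc ξ ^ P.d * (|τ| * (|f x'| * |g x'|) * |h x'|)
        ≤ ξ ^ P.d * (|τ| * (c₁ * (u ^ p)⁻¹ * (c₂ * ((u ^ q)⁻¹ * e))) * (3 * u)) := by
          refine mul_le_mul_of_nonneg_left ?_ hw
          exact mul_le_mul (mul_le_mul_of_nonneg_left (mul_le_mul hf' hg' (abs_nonneg _) (by positivity))
            (abs_nonneg τ)) hh' (abs_nonneg _) (by positivity)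
      _ = 3 * |τ| * c₁ * c₂ * (ξ ^ P.d * (((u ^ p)⁻¹ * (u ^ q)⁻¹ * u) * e)) := by ring
      _ = 3 * |τ| * c₁ * c₂ * (ξ ^ P.d * ((u ^ (2 - i))⁻¹ * e)) := by rw [hkey]
  have hsum : ∑ x' : Site P j, ξ ^ P.d * (((ξ * max (1 : ℝ) (supDist x x' : ℝ)) ^ (2 - i))⁻¹ *
      Real.exp (-(δ * (ξ * (supDist x x' : ℝ))))) ≤ 1 + radialConst 3 δ 1 i := by
    have hR : radialConst P.d δ ξ i ≤ radialConst 3 δ 1 i := by rw [hd]; exact radialConst_mono 3 hδ hξ1 i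
    interval_cases i
    · exact (sum_profile_le hd hξ hξ1 hδ x).trans (by linarith)
    · simp only [show 2 - 1 = 1 from rfl, pow_one]
      exact (sum_profile_one_le hd hξ hξ1 hδ x).trans (by linarith)
    · simp only [Nat.sub_self, pow_zero, inv_one, one_mul]
      exact (sum_exp_le hd hξ hξ1 hδ x).trans (by linarith)
  calc |∑ x' : Site P j, ξ ^ P.d * (τ * (f x' * g x') * h x')|
      ≤ ∑ x' : Site P j, |ξ ^ P.d * (τ * (f x' * g x') * h x')| := Finset.abs_sum_le_sum_abs _ _
    _ ≤ ∑ x' : Site P j, 3 * |τ| * c₁ * c₂ * (ξ ^ P.d * (((ξ * max (1 : ℝ) (supDist x x' : ℝ)) ^ (2 - i))⁻¹ *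
          Real.exp (-(δ * (ξ * (supDist x x' : ℝ)))))) := Finset.sum_le_sum fun x' _ => hpt x'
    _ ≤ 3 * |τ| * c₁ * c₂ * (1 + radialConst 3 δ 1 i) := by
        rw [← Finset.mul_sum]
        exact mul_le_mul_of_nonneg_left hsum (by positivity)

/-- kernel: `|Π_{μμ′ν}[X,Y](x)| ≤ B_A + B_B` from bounds of its two graphs (`kerC = −kerA + kerB`). [cite: Balaban1983Higgs3, (3.26) p.441] -/
theorem Pi3_abs_le (ξ τ : ℝ) (X Y : Kernel P j) (dx : Fin P.d → Site P j → Site P j → ℝ) (μ μ' ν : Fin P.d) (x : Site P j)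
    {BA BB : ℝ}
    (hA : |∑ x' : Site P j, ξ ^ P.d * (τ * (dAdjKernel ξ⁻¹ μ' X x x' * dAdjKernel ξ⁻¹ μ Y x' x) * dx ν x x')| ≤ BA)
    (hB : |∑ x' : Site P j, ξ ^ P.d * (τ * (X x x' * d2Kernel ξ⁻¹ μ' μ Y x' x) * dx ν x x')| ≤ BB) :
    |Pi3 ξ τ X Y dx μ μ' ν x| ≤ BA + BB := by
  have h : Pi3 ξ τ X Y dx μ μ' ν x =
      -(∑ x' : Site P j, ξ ^ P.d * (τ * (dAdjKernel ξ⁻¹ μ' X x x' * dAdjKernel ξ⁻¹ μ Y x' x) * dx ν x x')) +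
        ∑ x' : Site P j, ξ ^ P.d * (τ * (X x x' * d2Kernel ξ⁻¹ μ' μ Y x' x) * dx ν x x') := by
    rw [← Finset.sum_neg_distrib, ← Finset.sum_add_distrib]
    simp only [Pi3, kerC, kerA, kerB]
    exact Finset.sum_congr rfl fun x' _ => by ring
  rw [h]
  refine (abs_add_le _ _).trans (add_le_add ?_ hB)
  rwa [abs_neg]

end Generic

/-! ## §3 The instance: every configuration with at least one `M` is convergent -/

section Instance

/-- kernel: drop the exponential of a profile bound. [folklore] -/
private theorem drop_exp {v c q t : ℝ} (hc : 0 ≤ c) (hq : 0 ≤ q) (ht : 0 ≤ t) (h : v ≤ c * (q * Real.exp (-t))) : v ≤ c * q :=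
  h.trans (mul_le_mul_of_nonneg_left (mul_le_of_le_one_right hq (Real.exp_le_one_iff.mpr (by linarith))) hc)

/-- **p. 441, "If at least one propagator `G_{j₀}(0)` is replaced by `G_{j₀}(0)(1 − m²_{j₀} − a_{j₀}P_{j₀})C^ξ`, then we get a
convergent expression" — for `Π_{μμ′ν}` at the zero-field torus instance, ALL FIVE CONFIGURATIONS.**  For odd `L > 1`, `a > 0`,
`m² ≥ 0` there is `Cst > 0` (a function of `L, a, m²`) such that for every volume `P = (3, L, m, K)`, every `1 ≤ k ≤ K` (`ξ = L^{−k}`,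
`G = G^ξ_k(0)`, `C = C^ξ_T`, `M = G − C`), every `τ = tr q²`, every displacement reading `dx` with `|dx_ν(x,x′)| ≤ ξ|x−x′|₁`, and all
`μ, μ′, ν, y`: `|Π[M,G](y)|, |Π[G,M](y)|, |Π[M,M](y)|, |Π[C,M](y)|, |Π[M,C](y)| ≤ Cst·|τ|` (`Π = B3Sect3VectorSelfEnergy.Pi3 ξ τ`).
[cite: Balaban1983Higgs3, (3.26) p.441, (3.16) p.437] -/
theorem Pi3_replaced_convergent (L : ℕ) (hL : Odd L ∧ 1 < L) {a : ℝ} (ha : 0 < a) {msq : ℝ} (hmsq : 0 ≤ msq) :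
    ∃ Cst : ℝ, 0 < Cst ∧ ∀ (P : Params), P.d = 3 → P.L = L → ∀ k : ℕ, 1 ≤ k → k ≤ P.K →
      ∀ (τ : ℝ) (dx : Fin P.d → Site P 0 → Site P 0 → ℝ),
        (∀ (ν : Fin P.d) (x x' : Site P 0), |dx ν x x'| ≤ P.eta k * (Site.tdist x x' : ℝ)) →
      ∀ (μ μ' ν : Fin P.d) (y : Site P 0),
        |Pi3 (P.eta k) τ (Mxi P a msq k) (G0xi P a msq k) dx μ μ' ν y| ≤ Cst * |τ| ∧
        |Pi3 (P.eta k) τ (G0xi P a msq k) (Mxi P a msq k) dx μ μ' ν y| ≤ Cst * |τ| ∧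
        |Pi3 (P.eta k) τ (Mxi P a msq k) (Mxi P a msq k) dx μ μ' ν y| ≤ Cst * |τ| ∧
        |Pi3 (P.eta k) τ (CxiT (P.eta k)) (Mxi P a msq k) dx μ μ' ν y| ≤ Cst * |τ| ∧
        |Pi3 (P.eta k) τ (Mxi P a msq k) (CxiT (P.eta k)) dx μ μ' ν y| ≤ Cst * |τ| := by
  obtain ⟨δG, CG, hδG, hCG, HG⟩ := G0xi_all_bounds L hL ha hmsq
  obtain ⟨δM, CM, hδM, hCM, HM⟩ := Mxi_profiles L hL ha hmsq
  have hT := torusConst_nonneg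
  set cT : ℝ := torusConst + 472501 with hcT
  set cT' : ℝ := 3037500 + torusConst + 472501 with hcT'
  have hcT0 : 0 ≤ cT := by rw [hcT]; linarith
  have hcT0' : 0 ≤ cT' := by rw [hcT']; linarith
  have hRG0 := radialConst_nonneg 3 hδG zero_le_one 0
  have hRM0 := radialConst_nonneg 3 hδM zero_le_one 0
  have hRM1 := radialConst_nonneg 3 hδM zero_le_one 1
  have hRM2 := radialConst_nonneg 3 hδM zero_le_one 2
  -- the constants of the five configurations (A-graph + B-graph each)
  set K₁ : ℝ := 3 * CM * CG * (1 + radialConst 3 δG 1 0) + 3 * CM * CG * (1 + radialConst 3 δG 1 0) with hK₁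
  set K₂ : ℝ := 3 * CG * CM * (1 + radialConst 3 δM 1 0) + 3 * CG * CM * (1 + radialConst 3 δM 1 1) with hK₂
  set K₃ : ℝ := 3 * CM * CM * (1 + radialConst 3 δM 1 1) + 3 * CM * CM * (1 + radialConst 3 δM 1 2) with hK₃
  set K₄ : ℝ := 3 * cT' * CM * (1 + radialConst 3 δM 1 0) + 3 * cT * CM * (1 + radialConst 3 δM 1 1) with hK₄
  have hK₁0 : 0 ≤ K₁ := by positivity
  have hK₂0 : 0 ≤ K₂ := by positivity
  have hK₃0 : 0 ≤ K₃ := by positivity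
  have hK₄0 : 0 ≤ K₄ := by positivity
  refine ⟨K₁ + K₂ + K₃ + K₄ + 1, by positivity, fun P hPd hPL k hk1 hkK τ dx hdx μ μ' ν y => ?_⟩
  obtain ⟨hGv, -, hGa, hGm⟩ := HG P hPd hPL k hk1 hkK
  obtain ⟨hM0, -, hMa, hMm, -, -⟩ := HM P hPd hPL k hk1 hkK
  have hkm : k ≤ P.m + P.K := hkK.trans (Nat.le_add_left _ _)
  have hη : 0 < P.eta k := eta_pos P k
  have hη1 : P.eta k ≤ 1 := eta_le_one P k
  have hN : 1 ≤ P.eta k * (P.sitesPerDir 0 : ℝ) := one_le_eta_mul_sitesPerDir P hkm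
  have hh := abs_dx_le hPd hη dx hdx ν y
  have ht : ∀ (c : ℝ), 0 ≤ c → ∀ z : Site P 0, 0 ≤ c * (P.eta k * (supDist y z : ℝ)) := fun c hc z => by positivity
  -- the pointwise bounds in the shape `sum_term_le` wants (first slot: no exponential; distances from `y`)
  have fM0 : ∀ x' : Site P 0, |Mxi P a msq k y x'| ≤ CM * ((P.eta k * max (1 : ℝ) (supDist y x' : ℝ)) ^ 0)⁻¹ :=
    fun x' => by simpa using hM0 y x'
  have fMa : ∀ x' : Site P 0, |dAdjKernel (P.eta k)⁻¹ μ' (Mxi P a msq k) y x'| ≤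
      CM * ((P.eta k * max (1 : ℝ) (supDist y x' : ℝ)) ^ 1)⁻¹ := fun x' => by
    rw [pow_one]; exact drop_exp hCM.le (by positivity) (ht δM hδM.le x') (hMa μ' y x')
  have fGa : ∀ x' : Site P 0, |dAdjKernel (P.eta k)⁻¹ μ' (G0xi P a msq k) y x'| ≤
      CG * ((P.eta k * max (1 : ℝ) (supDist y x' : ℝ)) ^ 2)⁻¹ := fun x' =>
    drop_exp hCG.le (by positivity) (ht δG hδG.le x') (hGa μ' y x')
  have fGv : ∀ x' : Site P 0, |G0xi P a msq k y x'| ≤ CG * ((P.eta k * max (1 : ℝ) (supDist y x' : ℝ)) ^ 1)⁻¹ :=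
    fun x' => by rw [pow_one]; exact drop_exp hCG.le (by positivity) (ht δG hδG.le x') (hGv y x')
  have fCa : ∀ x' : Site P 0, |dAdjKernel (P.eta k)⁻¹ μ' (CxiT (P.eta k)) y x'| ≤
      cT' * ((P.eta k * max (1 : ℝ) (supDist y x' : ℝ)) ^ 2)⁻¹ := fun x' =>
    drop_exp hcT0' (by positivity) (ht (1 / 2) (by norm_num) x') (dAdjKernel_CxiT_profile hPd hη hη1 hN μ' y x')
  have fCv : ∀ x' : Site P 0, |CxiT (P.eta k) y x'| ≤ cT * ((P.eta k * max (1 : ℝ) (supDist y x' : ℝ)) ^ 1)⁻¹ :=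
    fun x' => by rw [pow_one]; exact drop_exp hcT0 (by positivity) (ht (1 / 2) (by norm_num) x') (abs_CxiT_profile hPd hη hη1 hN y x')
  -- second slot: kernels read at `(x′, y)`, distances rewritten from `y`
  have gGa : ∀ x' : Site P 0, |dAdjKernel (P.eta k)⁻¹ μ (G0xi P a msq k) x' y| ≤
      CG * (((P.eta k * max (1 : ℝ) (supDist y x' : ℝ)) ^ 2)⁻¹ * Real.exp (-(δG * (P.eta k * (supDist y x' : ℝ))))) :=
    fun x' => by rw [supDist_comm y x']; exact hGa μ x' y
  have gGm : ∀ x' : Site P 0, |d2Kernel (P.eta k)⁻¹ μ' μ (G0xi P a msq k) x' y| ≤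
      CG * (((P.eta k * max (1 : ℝ) (supDist y x' : ℝ)) ^ 3)⁻¹ * Real.exp (-(δG * (P.eta k * (supDist y x' : ℝ))))) :=
    fun x' => by rw [supDist_comm y x']; exact hGm μ' μ x' y
  have gMa : ∀ x' : Site P 0, |dAdjKernel (P.eta k)⁻¹ μ (Mxi P a msq k) x' y| ≤
      CM * (((P.eta k * max (1 : ℝ) (supDist y x' : ℝ)) ^ 1)⁻¹ * Real.exp (-(δM * (P.eta k * (supDist y x' : ℝ))))) :=
    fun x' => by rw [supDist_comm y x', pow_one]; exact hMa μ x' y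
  have gMm : ∀ x' : Site P 0, |d2Kernel (P.eta k)⁻¹ μ' μ (Mxi P a msq k) x' y| ≤
      CM * (((P.eta k * max (1 : ℝ) (supDist y x' : ℝ)) ^ 1)⁻¹ * Real.exp (-(δM * (P.eta k * (supDist y x' : ℝ))))) :=
    fun x' => by rw [supDist_comm y x', pow_one]; exact hMm μ' μ x' y
  -- the five configurations
  have h1 : |Pi3 (P.eta k) τ (Mxi P a msq k) (G0xi P a msq k) dx μ μ' ν y| ≤ K₁ * |τ| := by
    refine (Pi3_abs_le _ _ _ _ dx μ μ' ν y
      (sum_term_le hPd hη hη1 hδG (p := 1) (q := 2) (i := 0) rfl (by norm_num) hCM.le hCG.le τ y _ _ _ fMa gGa hh)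
      (sum_term_le hPd hη hη1 hδG (p := 0) (q := 3) (i := 0) rfl (by norm_num) hCM.le hCG.le τ y _ _ _ fM0 gGm hh)).trans ?_
    rw [hK₁]; ring_nf; rfl
  have h2 : |Pi3 (P.eta k) τ (G0xi P a msq k) (Mxi P a msq k) dx μ μ' ν y| ≤ K₂ * |τ| := by
    refine (Pi3_abs_le _ _ _ _ dx μ μ' ν y
      (sum_term_le hPd hη hη1 hδM (p := 2) (q := 1) (i := 0) rfl (by norm_num) hCG.le hCM.le τ y _ _ _ fGa gMa hh)
      (sum_term_le hPd hη hη1 hδM (p := 1) (q := 1) (i := 1) rfl (by norm_num) hCG.le hCM.le τ y _ _ _ fGv gMm hh)).trans ?_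
    rw [hK₂]; ring_nf; rfl
  have h3 : |Pi3 (P.eta k) τ (Mxi P a msq k) (Mxi P a msq k) dx μ μ' ν y| ≤ K₃ * |τ| := by
    refine (Pi3_abs_le _ _ _ _ dx μ μ' ν y
      (sum_term_le hPd hη hη1 hδM (p := 1) (q := 1) (i := 1) rfl (by norm_num) hCM.le hCM.le τ y _ _ _ fMa gMa hh)
      (sum_term_le hPd hη hη1 hδM (p := 0) (q := 1) (i := 2) rfl (by norm_num) hCM.le hCM.le τ y _ _ _ fM0 gMm hh)).trans ?_
    rw [hK₃]; ring_nf; rfl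
  have h4 : |Pi3 (P.eta k) τ (CxiT (P.eta k)) (Mxi P a msq k) dx μ μ' ν y| ≤ K₄ * |τ| := by
    refine (Pi3_abs_le _ _ _ _ dx μ μ' ν y
      (sum_term_le hPd hη hη1 hδM (p := 2) (q := 1) (i := 0) rfl (by norm_num) hcT0' hCM.le τ y _ _ _ fCa gMa hh)
      (sum_term_le hPd hη hη1 hδM (p := 1) (q := 1) (i := 1) rfl (by norm_num) hcT0 hCM.le τ y _ _ _ fCv gMm hh)).trans ?_
    rw [hK₄]; ring_nf; rfl
  -- `Π[M,C] = Π[M,G] − Π[M,M]`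
  have h5 : |Pi3 (P.eta k) τ (Mxi P a msq k) (CxiT (P.eta k)) dx μ μ' ν y| ≤ (K₁ + K₃) * |τ| := by
    rw [CxiT_eq_sub a msq k, ← Pi3_sub_right, add_mul]
    exact (abs_sub _ _).trans (add_le_add h1 h3)
  have hτ := abs_nonneg τ
  refine ⟨h1.trans ?_, h2.trans ?_, h3.trans ?_, h4.trans ?_, h5.trans ?_⟩ <;>
    exact mul_le_mul_of_nonneg_right (by linarith) hτ

/-- **THE HEADLINE: `|Π_{μμ′ν}[G^ξ_k(0), G^ξ_k(0)](y) − Π_{μμ′ν}[C^ξ_T, C^ξ_T](y)| ≤ Cst·|tr q²|` uniformly in the volume and in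
`1 ≤ k ≤ K`** — the p. 441 replacement *"Hence it is enough to consider the expressions with the propagator C^ξ only"* for the
first-curly-bracket function of (3.26) at the zero-field torus instance (`d = 3`), for every displacement reading with
`|dx_ν(x,x′)| ≤ ξ|x−x′|₁`. [cite: Balaban1983Higgs3, (3.26) p.441, (3.16) p.437] -/
theorem Pi3_G0xi_sub_CxiT (L : ℕ) (hL : Odd L ∧ 1 < L) {a : ℝ} (ha : 0 < a) {msq : ℝ} (hmsq : 0 ≤ msq) :
    ∃ Cst : ℝ, 0 < Cst ∧ ∀ (P : Params), P.d = 3 → P.L = L → ∀ k : ℕ, 1 ≤ k → k ≤ P.K →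
      ∀ (τ : ℝ) (dx : Fin P.d → Site P 0 → Site P 0 → ℝ),
        (∀ (ν : Fin P.d) (x x' : Site P 0), |dx ν x x'| ≤ P.eta k * (Site.tdist x x' : ℝ)) →
      ∀ (μ μ' ν : Fin P.d) (y : Site P 0),
        |Pi3 (P.eta k) τ (G0xi P a msq k) (G0xi P a msq k) dx μ μ' ν y -
            Pi3 (P.eta k) τ (CxiT (P.eta k)) (CxiT (P.eta k)) dx μ μ' ν y| ≤ Cst * |τ| := by
  obtain ⟨Cst, hCst, H⟩ := Pi3_replaced_convergent L hL ha hmsq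
  refine ⟨2 * Cst, by positivity, fun P hPd hPL k hk1 hkK τ dx hdx μ μ' ν y => ?_⟩
  obtain ⟨h1, -, -, h4, -⟩ := H P hPd hPL k hk1 hkK τ dx hdx μ μ' ν y
  rw [Pi3_split, ← Mxi_eq_sub]
  calc _ ≤ Cst * |τ| + Cst * |τ| := (abs_add_le _ _).trans (add_le_add h1 h4)
    _ = 2 * Cst * |τ| := by ring

/-- **The same with the printed displacement `(x′_ν − x_ν)` along `Γ_{x,x′}`** (`B3Taylor310Remainder.disp ξ⁻¹`, the reading used by
r15's (3.26)/(3.10) files and gen 6 `B3Bound316ZeroTorus`): `|x′_ν − x_ν| ≤ ξ|x−x′|₁` (`B3Bound316.abs_disp_le`).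
[cite: Balaban1983Higgs3, (3.26) p.441, (3.10) p.435] -/
theorem Pi3_G0xi_sub_CxiT_disp (L : ℕ) (hL : Odd L ∧ 1 < L) {a : ℝ} (ha : 0 < a) {msq : ℝ} (hmsq : 0 ≤ msq) :
    ∃ Cst : ℝ, 0 < Cst ∧ ∀ (P : Params), P.d = 3 → P.L = L → ∀ k : ℕ, 1 ≤ k → k ≤ P.K →
      ∀ (τ : ℝ) (μ μ' ν : Fin P.d) (y : Site P 0),
        |Pi3 (P.eta k) τ (G0xi P a msq k) (G0xi P a msq k) (fun ν x x' => disp (P.eta k)⁻¹ x x' ν) μ μ' ν y -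
            Pi3 (P.eta k) τ (CxiT (P.eta k)) (CxiT (P.eta k)) (fun ν x x' => disp (P.eta k)⁻¹ x x' ν) μ μ' ν y| ≤
          Cst * |τ| := by
  obtain ⟨Cst, hCst, H⟩ := Pi3_G0xi_sub_CxiT L hL ha hmsq
  refine ⟨Cst, hCst, fun P hPd hPL k hk1 hkK τ μ μ' ν y => H P hPd hPL k hk1 hkK τ _ (fun ν x x' => ?_) μ μ' ν y⟩
  have h := abs_disp_le (inv_pos.mpr (eta_pos P k)) x x' ν
  rwa [inv_inv] at h

end Instance

end

end Literature.MathematicalPhysics.QuantumFieldTheory.Balaban1983to89.B3Pi3CrossTermsZeroTorus
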